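import Summits.RiemannHypothesis.RiemannHypothesis.Theorems.PfPersistenceTwoParityIndexLevels
import HarnessLib

/-!
# PF-persistence, cand-7 seat (pub-rhpf, gen 5), two-parity index ladder, part 4/4: the ODD "≥" half —
# negative-definite odd families on long windows; the full real index is EXACTLY `2K` (`K < ∞`)

pub-rhpf cell, candidate seat 7 (floating B), generation 5.  HONEST FRAMING (page 1 of everything in this
cell): a long-odds MECHANISM / RIGIDITY SEARCH around Weil's quadratic functional; NOTHING here claims,
approaches or conditionally proves RH.  Labels: PROVED = kernel-checked (this file, RH-free throughout);
CITED = in print (E. Bombieri, Rend. Mat. Acc. Lincei (9) 11 (2000), Thm 8: `2K` negative eigenvalues of the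
full form, Thm 9: `K` per parity sector [Bombieri2000Weil]); HYPOTHESIS = an explicit binder.

Notation as in parts 1–3: `Q = weilQuadratic`, `ĝ = weilMellin g`, `𝒬` = quadrant zeros, `K = #𝒬`.
PROVED here (all RH-free): `exists_oddRealTest_weilMellin_eq` — ODD interpolation on a finite quadrant set
(`ψ = φ'` for the M2 seat's EVEN real interpolant `φ` of the values `-v(ρ)/(ρ - 1/2)`; Literature
`weilMellin_deriv`: `(φ')^ = -(s - 1/2) φ̂`; `φ'` is odd, real, supported in `tsupport φ` — the M2 seat's recipe
of record); `im_weilMellin_eq_zero_of_offline_odd` — for odd real `g`, `Im ĝ = 0` on `𝒬` transports to every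
off-line zero (values `x, x̄, -x, -x̄` on a quadruple); `exists_negative_definite_odd_family_of_finite` — THE
ODD "≥" HALF: `𝒬` finite, `n ≤ K` ⇒ a window `A` and `n` odd real Weil tests supported in `[-A, A]` with `Re Q`
NEGATIVE DEFINITE on their real span (port of the M2 even construction with parity signs swapped: interpolate
`ψ̂ᵢ(ρⱼ) = δᵢⱼ` REAL — for odd real tests `P_g = -ĝ²`, so the tuned term `-(Re ĝᵢ(ρᵢ))² = -cosh²(δᵢTᵢ)` is the
negative one; positive part `Σ m (Im Ĝ)² ≤ (Σcᵢ²)Λ` since `Im ĝᵢ` vanishes off the line and `|ĝᵢ| ≤ |ψ̂ᵢ|` on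
it; negative part `≤ -(Σcᵢ²)(Λ + 1)`).  Consequences: `oddIndexLowerHalf : OddIndexLowerHalf` (part 3's
HYPOTHESIS binder DISCHARGED); odd index on long windows EXACTLY `K` (`exists_oddNegIndexAtLeast_iff`,
`not_oddNegIndexAtLeast_succ_iff`); full REAL index EXACTLY `2K` (`exists_realNegIndexAtLeast_iff`,
`not_realNegIndexAtLeast_succ_iff`: level `n + 1` clean at every window `⟺ 2K ≤ n`), all under `K < ∞` —
Bombieri's Thm 8 / Thm 9 counts for the UNTRUNCATED form, window-uniform, both halves, both parities.

What this does NOT touch: `K = ∞`; any lower bound on a FIRST level (Weil positivity = RH-strength).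
-/

noncomputable section

set_option linter.dupNamespace false

open Complex Filter Set MeasureTheory
open scoped Real Topology ComplexConjugate BigOperators

namespace Summit.RiemannHypothesis.RiemannHypothesis.Theorems.PfPersistenceParityIndex

open Literature.NumberTheory.LFunctions
open Literature.NumberTheory.LFunctions.WeilConverse
open Literature.NumberTheory.LFunctions.ZetaZeros
open Summit.RiemannHypothesis.RiemannHypothesis.Theorems.RuelleBandExactFirstBand
  (weilMellin_one_sub_of_odd conj_weilMellin_of_real pairCoeff_of_odd_real
    isWeilTest_symTranslate symTranslate_odd symTranslate_im weilMellin_symTranslate)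
open Summit.RiemannHypothesis.RiemannHypothesis.Theorems.PfPersistenceM2NegIndex

set_option quotPrecheck false in  -- `𝒬` = open quadrant of non-trivial zeros (NOTATION, parts 1–3)
local notation "𝒬" => {ρ : ℂ | ρ ∈ riemannZetaNontrivialZeros ∧ 1 / 2 < ρ.re ∧ 0 < ρ.im}

/-! ## A. Odd interpolation by differentiating the even interpolant -/

/-- The derivative of an even function is odd. [folklore] -/
theorem deriv_neg_of_even {φ : ℝ → ℂ} (heven : ∀ t : ℝ, φ (-t) = φ t) (t : ℝ) :
    deriv φ (-t) = -deriv φ t := by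
  have hfun : (fun x : ℝ ↦ φ (-x)) = φ := funext heven
  have h := deriv_comp_neg φ t
  rw [hfun] at h
  rw [h, neg_neg]

/-- The derivative of a differentiable real-valued function `ℝ → ℂ` is real-valued (`conj ∘ φ = φ`, so
`conj (φ' t) = φ' t` by uniqueness of derivatives). [folklore] -/
theorem im_deriv_eq_zero_of_real {φ : ℝ → ℂ} (hφ : Differentiable ℝ φ) (hreal : ∀ t : ℝ, (φ t).im = 0)
    (t : ℝ) : (deriv φ t).im = 0 := by
  have hfun : (fun x : ℝ ↦ star (φ x)) = φ := funext fun x ↦ Complex.conj_eq_iff_im.2 (hreal x)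
  have h1 : HasDerivAt φ (star (deriv φ t)) t := by
    have h := (hφ t).hasDerivAt.star
    rwa [hfun] at h
  exact Complex.conj_eq_iff_im.1 (h1.unique (hφ t).hasDerivAt)

/-- **Odd interpolation.**  For a finite set `Z` in the open quadrant `Re ρ > 1/2, Im ρ > 0` and any values
`v` there is an ODD, real-valued Weil test `ψ` supported in `[-1, 1]` with `ψ̂(ρ) = v(ρ)` on `Z`: take
`ψ = φ'` for the even real interpolant `φ` of the values `-v(ρ)/(ρ - 1/2)` (`(φ')^(s) = -(s - 1/2) φ̂(s)`).
[folklore] -/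
theorem exists_oddRealTest_weilMellin_eq (Z : Finset ℂ) (hZ : ∀ ρ ∈ Z, 1 / 2 < ρ.re ∧ 0 < ρ.im)
    (v : ℂ → ℂ) :
    ∃ ψ : ℝ → ℂ, IsWeilTest ψ ∧ (∀ t : ℝ, ψ (-t) = -ψ t) ∧ (∀ t : ℝ, (ψ t).im = 0) ∧
      tsupport ψ ⊆ Icc (-1) 1 ∧ ∀ ρ ∈ Z, weilMellin ψ ρ = v ρ := by
  obtain ⟨φ, hφt, hφe, hφr, hφs, hφv⟩ :=
    exists_evenRealTest_weilMellin_eq Z hZ fun ρ ↦ -v ρ / (ρ - 1 / 2)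
  refine ⟨deriv φ, hφt.deriv, deriv_neg_of_even hφe,
    im_deriv_eq_zero_of_real (hφt.1.differentiable (by simp)) hφr, tsupport_deriv_subset.trans hφs,
    fun ρ hρ ↦ ?_⟩
  have hne : (ρ : ℂ) - 1 / 2 ≠ 0 := fun h ↦ by
    have := congrArg Complex.re h
    norm_num [Complex.sub_re] at this
    linarith [(hZ ρ hρ).1]
  rw [weilMellin_deriv hφt, hφv ρ hρ]
  calc -(ρ - 1 / 2) * (-v ρ / (ρ - 1 / 2)) = (ρ - 1 / 2) / (ρ - 1 / 2) * v ρ := by ring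
    _ = v ρ := by rw [div_self hne, one_mul]

/-! ## B. Transport of `Im ĝ = 0` from the quadrant to every off-line zero (odd real `g`) -/

/-- For an odd real `g` the quadruple `ρ, ρ̄, 1-ρ, 1-ρ̄` carries `x, x̄, -x, -x̄`; so if `Im ĝ` vanishes on a
set `Z` containing the quadrant zeros, then `Im ĝ(ρ) = 0` at every OFF-LINE non-trivial zero `ρ`.
[cite: Bombieri2000Weil, Thm 9] -/
theorem im_weilMellin_eq_zero_of_offline_odd {g : ℝ → ℂ} (hodd : ∀ t : ℝ, g (-t) = -g t)
    (hreal : ∀ t : ℝ, (g t).im = 0) {Z : Set ℂ}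
    (hZ : ∀ ρ ∈ riemannZetaNontrivialZeros, 1 / 2 < ρ.re → 0 < ρ.im → ρ ∈ Z)
    (hvan : ∀ ρ ∈ Z, (weilMellin g ρ).im = 0) {ρ : ℂ} (hρ : ρ ∈ riemannZetaNontrivialZeros)
    (hline : ρ.re ≠ 1 / 2) : (weilMellin g ρ).im = 0 := by
  have him : ρ.im ≠ 0 := riemannZetaNontrivialZeros.im_ne_zero hρ
  rcases lt_or_gt_of_ne hline with hlt | hgt
  · rcases lt_or_gt_of_ne him with hneg | hpos
    · have hmem : 1 - ρ ∈ riemannZetaNontrivialZeros := by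
        simpa using riemannZetaNontrivialZeros.one_sub_conj_mem (riemannZetaNontrivialZeros.conj_mem hρ)
      have h1 := hvan _ (hZ _ hmem (by simp only [Complex.sub_re, Complex.one_re]; linarith)
        (by simp only [Complex.sub_im, Complex.one_im]; linarith))
      rw [weilMellin_one_sub_of_odd hodd, Complex.neg_im] at h1
      linarith
    · have hmem := riemannZetaNontrivialZeros.one_sub_conj_mem hρ
      have h1 := hvan _ (hZ _ hmem (by simp only [Complex.sub_re, Complex.one_re, Complex.conj_re]; linarith)
        (by simp only [Complex.sub_im, Complex.one_im, Complex.conj_im]; linarith))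
      rw [weilMellin_one_sub_of_odd hodd, ← conj_weilMellin_of_real hreal, Complex.neg_im,
        Complex.conj_im] at h1
      linarith
  · rcases lt_or_gt_of_ne him with hneg | hpos
    · have hmem := riemannZetaNontrivialZeros.conj_mem hρ
      have h1 := hvan _ (hZ _ hmem (by simp only [Complex.conj_re]; linarith)
        (by simp only [Complex.conj_im]; linarith))
      rw [← conj_weilMellin_of_real hreal, Complex.conj_im] at h1
      linarith
    · exact hvan _ (hZ _ hρ hgt hpos)

/-! ## C. Negative-definite ODD families on long windows, under finitely many off-line zeros -/

/-- **The odd "≥" half of Bombieri's count, window-uniform, for the untruncated Weil form.**  If `ζ` has only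
finitely many zeros in the open quadrant then for every `n ≤ K` there are a window `A` and `n` ODD, real-valued
Weil tests `g₁, …, g_n` supported in `[-A, A]` with `Re Q(Σ cᵢ gᵢ) < 0` for every real `c ≠ 0`.
Construction: odd interpolants `ψ̂ᵢ(ρⱼ) = δᵢⱼ` on the quadrant set; `gᵢ = (ψᵢ(· - Tᵢ) + ψᵢ(· + Tᵢ))/2` with
`Tᵢ ∈ (2π/γᵢ)ℕ` tuned so that `ĝᵢ(ρᵢ) = κᵢ = cosh(δᵢTᵢ) ≥ Λ + 1` (REAL), `Λ = Σᵢ Σ_ρ m(ρ)‖P_{ψᵢ}(ρ)‖`.  For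
`G = Σ cᵢ gᵢ` (odd, real): `Re Q(G) = Σ_ρ m(ρ)((Im Ĝ)² - (Re Ĝ)²)(ρ)` (`P_G = -Ĝ²`); positive part
`≤ (Σcᵢ²)Λ` (`Im ĝᵢ = 0` off the line by B, `|ĝᵢ| ≤ |ψ̂ᵢ|` on it), negative part `≤ -(Σcᵢ²)(Λ + 1)`.
[cite: Bombieri2000Weil, Thm 9 (odd part); Thm 8] -/
theorem exists_negative_definite_odd_family_of_finite (hfin : Set.Finite 𝒬) {n : ℕ}
    (hn : n ≤ hfin.toFinset.card) :
    ∃ A : ℝ, ∃ g : Fin n → ℝ → ℂ, (∀ i, IsWeilTest (g i)) ∧ (∀ i (t : ℝ), g i (-t) = -g i t) ∧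
      (∀ i (t : ℝ), (g i t).im = 0) ∧ (∀ i, tsupport (g i) ⊆ Icc (-A) A) ∧
      ∀ c : Fin n → ℝ, c ≠ 0 → (weilQuadratic (fun t : ℝ ↦ ∑ i, (c i : ℂ) * g i t)).re < 0 := by
  classical
  set Z : Finset ℂ := hfin.toFinset with hZdef
  have hZmem : ∀ ρ : ℂ, ρ ∈ Z ↔ ρ ∈ riemannZetaNontrivialZeros ∧ 1 / 2 < ρ.re ∧ 0 < ρ.im :=
    fun ρ ↦ hfin.mem_toFinset
  have hZq : ∀ ρ ∈ Z, 1 / 2 < ρ.re ∧ 0 < ρ.im := fun ρ hρ ↦ ((hZmem ρ).1 hρ).2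
  have hZall : ∀ ρ ∈ riemannZetaNontrivialZeros, 1 / 2 < ρ.re → 0 < ρ.im → ρ ∈ (Z : Set ℂ) :=
    fun ρ hρ h1 h2 ↦ Finset.mem_coe.2 ((hZmem ρ).2 ⟨hρ, h1, h2⟩)
  -- `n` distinct quadrant zeros `e i`
  let e : Fin n → ℂ := fun i ↦ (Z.equivFin.symm (Fin.castLE hn i) : ℂ)
  have he_mem : ∀ i, e i ∈ Z := fun i ↦ (Z.equivFin.symm (Fin.castLE hn i)).2
  have he_inj : Function.Injective e := fun i j h ↦
    Fin.castLE_injective hn (Z.equivFin.symm.injective (Subtype.ext h))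
  have he_ntz : ∀ i, e i ∈ riemannZetaNontrivialZeros := fun i ↦ ((hZmem _).1 (he_mem i)).1
  have hδ : ∀ i, 0 < (e i).re - 1 / 2 := fun i ↦ by linarith [(hZq _ (he_mem i)).1]
  have hγ : ∀ i, 0 < (e i).im := fun i ↦ (hZq _ (he_mem i)).2
  -- Step 1: odd interpolating tests `ψ i` with `ψ̂ᵢ = [ρ = e i]` (REAL values) on `Z`
  have hψ : ∀ i : Fin n, ∃ ψ : ℝ → ℂ, IsWeilTest ψ ∧ (∀ t : ℝ, ψ (-t) = -ψ t) ∧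
      (∀ t : ℝ, (ψ t).im = 0) ∧ tsupport ψ ⊆ Icc (-1) 1 ∧
      ∀ ρ ∈ Z, weilMellin ψ ρ = if ρ = e i then 1 else 0 := fun i ↦
    exists_oddRealTest_weilMellin_eq Z hZq fun ρ ↦ if ρ = e i then 1 else 0
  choose ψ hψt hψo hψr hψs hψv using hψ
  -- Step 2: the total zero-side mass `Λ` of the `ψ i`
  set Λ : ℝ := ∑ i, ∑' ρ : riemannZetaNontrivialZeros,
      ‖(riemannZetaZeroOrder (ρ : ℂ) : ℂ) * pairCoeff (ψ i) ρ‖ with hΛdef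
  have hΛ0 : 0 ≤ Λ := Finset.sum_nonneg fun i _ ↦ tsum_nonneg fun ρ ↦ norm_nonneg _
  -- Step 3: tuned translation lengths `T i ∈ (2π/γᵢ)ℕ` with `δᵢ Tᵢ ≥ 2Λ + 1`
  have hT : ∀ i, ∃ T : ℝ, 0 ≤ T ∧ (∃ k : ℕ, (e i).im * T = 2 * π * k) ∧
      2 * Λ + 1 ≤ ((e i).re - 1 / 2) * T := by
    intro i
    obtain ⟨k, hk⟩ := exists_nat_ge ((2 * Λ + 1) * (e i).im / (2 * π * ((e i).re - 1 / 2)))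
    refine ⟨2 * π * k / (e i).im, div_nonneg (by positivity) (hγ i).le, ⟨k, ?_⟩, ?_⟩
    · rw [mul_div_assoc', mul_div_cancel_left₀ _ (hγ i).ne']
    · have h1 : (2 * Λ + 1) * (e i).im ≤ k * (2 * π * ((e i).re - 1 / 2)) :=
        (div_le_iff₀ (mul_pos (mul_pos two_pos Real.pi_pos) (hδ i))).1 hk
      rw [mul_div_assoc', le_div_iff₀ (hγ i)]
      linarith [h1]
  choose T hT0 hTk hTδ using hT
  -- Step 4: the family: symmetric translates `g i` of the `ψ i` by `T i`; window `A = 1 + Σ T i`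
  set g : Fin n → ℝ → ℂ := fun i t ↦ (ψ i (t - T i) + ψ i (t + T i)) / 2 with hgdef
  have hgt : ∀ i, IsWeilTest (g i) := fun i ↦ isWeilTest_symTranslate (hψt i) (T i)
  have hgo : ∀ i (t : ℝ), g i (-t) = -g i t := fun i t ↦ symTranslate_odd (hψo i) (T i) t
  have hgr : ∀ i (t : ℝ), (g i t).im = 0 := fun i t ↦ symTranslate_im (hψr i) (T i) t
  have hgm : ∀ i (s : ℂ), weilMellin (g i) s =
      weilMellin (ψ i) s * ((cexp ((s - 1 / 2) * T i) + cexp (-((s - 1 / 2) * T i))) / 2) :=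
    fun i s ↦ weilMellin_symTranslate (hψt i) (T i) s
  refine ⟨1 + ∑ i, T i, g, hgt, hgo, hgr, fun i ↦ ?_, fun c hc ↦ ?_⟩
  · have hTi : T i ≤ ∑ j, T j := Finset.single_le_sum (f := T) (fun j _ ↦ hT0 j) (Finset.mem_univ i)
    refine (tsupport_symTranslate_subset (hψs i) (hT0 i)).trans (Icc_subset_Icc ?_ ?_) <;> linarith
  -- Step 5: the combination `G = Σ cᵢ gᵢ` is an odd real Weil test with `Ĝ = Σ cᵢ ĝᵢ`
  have hGtest : IsWeilTest (fun t : ℝ ↦ ∑ i, (c i : ℂ) * g i t) := isWeilTest_combination g hgt c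
  have hGodd : ∀ t : ℝ, (fun t : ℝ ↦ ∑ i, (c i : ℂ) * g i t) (-t) =
      -(fun t : ℝ ↦ ∑ i, (c i : ℂ) * g i t) t := fun t ↦ by
    simp only [hgo, mul_neg, Finset.sum_neg_distrib]
  have hGreal : ∀ t : ℝ, ((fun t : ℝ ↦ ∑ i, (c i : ℂ) * g i t) t).im = 0 := fun t ↦ by
    simp [Complex.im_sum, Complex.mul_im, hgr]
  have hGmellin : ∀ s : ℂ, weilMellin (fun t : ℝ ↦ ∑ i, (c i : ℂ) * g i t) s =
      ∑ i, (c i : ℂ) * weilMellin (g i) s := weilMellin_combination g hgt c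
  set G : ℝ → ℂ := fun t : ℝ ↦ ∑ i, (c i : ℂ) * g i t with hGdef
  -- Step 6: `Re Q(G) = Σ m Y² - Σ m X²` with `X = Re Ĝ`, `Y = Im Ĝ` (odd: `P_G = -Ĝ²`)
  have hQ : zeroForm G = weilQuadratic G :=
    tendsto_nhds_unique (hasWeilZeroSide_zeroForm hGtest)
      (explicit_formula_holds (hGtest.weilConv hGtest.weilReflect))
  have hm0 : ∀ ρ : riemannZetaNontrivialZeros, (0 : ℝ) ≤ (riemannZetaZeroOrder (ρ : ℂ) : ℝ) := fun ρ ↦ by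
    have h0 : (0 : ℤ) ≤ riemannZetaZeroOrder (ρ : ℂ) :=
      le_trans zero_le_one (riemannZetaNontrivialZeros.one_le_order ρ.2)
    exact_mod_cast h0
  have hm1 : ∀ ρ : riemannZetaNontrivialZeros, (1 : ℝ) ≤ (riemannZetaZeroOrder (ρ : ℂ) : ℝ) := fun ρ ↦ by
    exact_mod_cast riemannZetaNontrivialZeros.one_le_order ρ.2
  set X : riemannZetaNontrivialZeros → ℝ := fun ρ ↦ (weilMellin G ρ).re with hXdef
  set Y : riemannZetaNontrivialZeros → ℝ := fun ρ ↦ (weilMellin G ρ).im with hYdef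
  have hP : ∀ ρ : riemannZetaNontrivialZeros, pairCoeff G ρ = -(weilMellin G ρ * weilMellin G ρ) :=
    fun ρ ↦ pairCoeff_of_odd_real hGodd hGreal ρ
  have hterm : ∀ ρ : riemannZetaNontrivialZeros, ((riemannZetaZeroOrder (ρ : ℂ) : ℂ) * pairCoeff G ρ).re =
      (riemannZetaZeroOrder (ρ : ℂ) : ℝ) * Y ρ ^ 2 - (riemannZetaZeroOrder (ρ : ℂ) : ℝ) * X ρ ^ 2 :=
    fun ρ ↦ by
      rw [hP ρ]
      simp only [Complex.mul_re, Complex.mul_im, Complex.neg_re, Complex.neg_im, Complex.intCast_re,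
        Complex.intCast_im, hXdef, hYdef]
      ring
  have hnorm : ∀ ρ : riemannZetaNontrivialZeros, ‖(riemannZetaZeroOrder (ρ : ℂ) : ℂ) * pairCoeff G ρ‖ =
      (riemannZetaZeroOrder (ρ : ℂ) : ℝ) * (X ρ ^ 2 + Y ρ ^ 2) := fun ρ ↦ by
    rw [norm_mul, Complex.norm_intCast, hP ρ, norm_neg, norm_mul, ← sq, Complex.sq_norm,
      Complex.normSq_apply, abs_of_nonneg (hm0 ρ)]
    simp only [hXdef, hYdef]
    ring
  have hsumN := summable_norm_pairCoeff hGtest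
  have hsumX : Summable fun ρ : riemannZetaNontrivialZeros ↦ (riemannZetaZeroOrder (ρ : ℂ) : ℝ) * X ρ ^ 2 :=
    Summable.of_nonneg_of_le (fun ρ ↦ mul_nonneg (hm0 ρ) (sq_nonneg _))
      (fun ρ ↦ by rw [hnorm]; nlinarith [hm0 ρ, sq_nonneg (Y ρ)]) hsumN
  have hsumY : Summable fun ρ : riemannZetaNontrivialZeros ↦ (riemannZetaZeroOrder (ρ : ℂ) : ℝ) * Y ρ ^ 2 :=
    Summable.of_nonneg_of_le (fun ρ ↦ mul_nonneg (hm0 ρ) (sq_nonneg _))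
      (fun ρ ↦ by rw [hnorm]; nlinarith [hm0 ρ, sq_nonneg (X ρ)]) hsumN
  have hre : (weilQuadratic G).re =
      ∑' ρ : riemannZetaNontrivialZeros, (riemannZetaZeroOrder (ρ : ℂ) : ℝ) * Y ρ ^ 2 -
        ∑' ρ : riemannZetaNontrivialZeros, (riemannZetaZeroOrder (ρ : ℂ) : ℝ) * X ρ ^ 2 := by
    rw [← hQ, zeroForm, Complex.re_tsum (summable_pairCoeff hGtest), ← hsumY.tsum_sub hsumX]
    exact tsum_congr hterm
  -- Step 7: the positive part is at most `S Λ`, `S = Σ cᵢ²`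
  set S : ℝ := ∑ i, c i ^ 2 with hSdef
  have hSpos : 0 < S := by
    obtain ⟨i, hi⟩ : ∃ i, c i ≠ 0 := Function.ne_iff.1 hc
    have h1 : c i ^ 2 ≤ S :=
      Finset.single_le_sum (f := fun j ↦ c j ^ 2) (fun j _ ↦ sq_nonneg (c j)) (Finset.mem_univ i)
    have h2 : 0 < c i ^ 2 := lt_of_le_of_ne (sq_nonneg _) (Ne.symm (pow_ne_zero 2 hi))
    linarith
  set P : riemannZetaNontrivialZeros → ℝ := fun ρ ↦
    ∑ i, ‖(riemannZetaZeroOrder (ρ : ℂ) : ℂ) * pairCoeff (ψ i) ρ‖ with hPdef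
  have hsumP : Summable P := summable_sum fun i _ ↦ summable_norm_pairCoeff (hψt i)
  have hPtsum : ∑' ρ, P ρ = Λ := Summable.tsum_finsetSum fun i _ ↦ summable_norm_pairCoeff (hψt i)
  -- per-zero domination `(Im ĝᵢ(ρ))² ≤ ‖ψ̂ᵢ(ρ)‖²`: on the line `|factor| ≤ 1`; off the line `Im ĝᵢ(ρ) = 0`
  have hImg : ∀ i, ∀ ρ ∈ riemannZetaNontrivialZeros,
      (weilMellin (g i) ρ).im ^ 2 ≤ ‖weilMellin (ψ i) ρ‖ ^ 2 := by
    intro i ρ hρ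
    by_cases hline : ρ.re = 1 / 2
    · calc (weilMellin (g i) ρ).im ^ 2 ≤ ‖weilMellin (g i) ρ‖ ^ 2 := by
            rw [Complex.sq_norm, Complex.normSq_apply]
            nlinarith [sq_nonneg (weilMellin (g i) ρ).re]
        _ ≤ ‖weilMellin (ψ i) ρ‖ ^ 2 := by
          rw [hgm, norm_mul]
          exact pow_le_pow_left₀ (by positivity)
            (mul_le_of_le_one_right (norm_nonneg _) (norm_coshFactor_le_one hline (T i))) 2
    · have hvan : ∀ ρ' ∈ (Z : Set ℂ), (weilMellin (g i) ρ').im = 0 := by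
        intro ρ' hρ'
        rw [hgm, hψv i ρ' (Finset.mem_coe.1 hρ')]
        split_ifs with h
        · obtain ⟨k, hk⟩ := hTk i
          rw [h, coshFactor_eq_of_tuned hk]
          simp only [Complex.mul_im, Complex.one_re, Complex.one_im, Complex.ofReal_re, Complex.ofReal_im,
            zero_mul, mul_zero, add_zero]
        · simp
      rw [im_weilMellin_eq_zero_of_offline_odd (hgo i) (hgr i) hZall hvan hρ hline, sq, mul_zero]
      positivity
  have hYb : ∀ ρ : riemannZetaNontrivialZeros, (riemannZetaZeroOrder (ρ : ℂ) : ℝ) * Y ρ ^ 2 ≤ S * P ρ := by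
    intro ρ
    have hYeq : Y ρ = ∑ i, c i * (weilMellin (g i) ρ).im := by
      simp only [hYdef, hGmellin, Complex.im_sum, Complex.im_ofReal_mul]
    have h1 : Y ρ ^ 2 ≤ S * ∑ i, (weilMellin (g i) ρ).im ^ 2 := by
      rw [hYeq]
      exact Finset.sum_mul_sq_le_sq_mul_sq Finset.univ c fun i ↦ (weilMellin (g i) ρ).im
    have h2 : ∑ i, (weilMellin (g i) ρ).im ^ 2 ≤ ∑ i, ‖weilMellin (ψ i) ρ‖ ^ 2 :=
      Finset.sum_le_sum fun i _ ↦ hImg i ρ ρ.2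
    have h3 : (riemannZetaZeroOrder (ρ : ℂ) : ℝ) * ∑ i, ‖weilMellin (ψ i) (ρ : ℂ)‖ ^ 2 = P ρ := by
      simp only [hPdef, Finset.mul_sum]
      refine Finset.sum_congr rfl fun i _ ↦ ?_
      rw [norm_mul, Complex.norm_intCast, pairCoeff_of_odd_real (hψo i) (hψr i), norm_neg, norm_mul, ← sq,
        abs_of_nonneg (hm0 ρ)]
    calc (riemannZetaZeroOrder (ρ : ℂ) : ℝ) * Y ρ ^ 2
        ≤ (riemannZetaZeroOrder (ρ : ℂ) : ℝ) * (S * ∑ i, (weilMellin (g i) ρ).im ^ 2) :=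
          mul_le_mul_of_nonneg_left h1 (hm0 ρ)
      _ ≤ (riemannZetaZeroOrder (ρ : ℂ) : ℝ) * (S * ∑ i, ‖weilMellin (ψ i) ρ‖ ^ 2) :=
          mul_le_mul_of_nonneg_left (mul_le_mul_of_nonneg_left h2 hSpos.le) (hm0 ρ)
      _ = S * P ρ := by rw [← h3]; ring
  have hYsum : ∑' ρ : riemannZetaNontrivialZeros, (riemannZetaZeroOrder (ρ : ℂ) : ℝ) * Y ρ ^ 2 ≤ S * Λ := by
    calc ∑' ρ : riemannZetaNontrivialZeros, (riemannZetaZeroOrder (ρ : ℂ) : ℝ) * Y ρ ^ 2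
        ≤ ∑' ρ, S * P ρ := hsumY.tsum_le_tsum hYb (hsumP.mul_left S)
      _ = S * Λ := by rw [tsum_mul_left, hPtsum]
  -- Step 8: the negative part: `Σ m X² ≥ S (Λ + 1)` from the `n` tuned zeros `e i` alone
  set κ : Fin n → ℝ := fun i ↦
    (Real.exp (((e i).re - 1 / 2) * T i) + Real.exp (-(((e i).re - 1 / 2) * T i))) / 2 with hκdef
  have hκ1 : ∀ i, Λ + 1 ≤ κ i := fun i ↦ by
    have h1 : ((e i).re - 1 / 2) * T i + 1 ≤ Real.exp (((e i).re - 1 / 2) * T i) :=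
      Real.add_one_le_exp _
    have h2 : 0 < Real.exp (-(((e i).re - 1 / 2) * T i)) := Real.exp_pos _
    simp only [hκdef]
    linarith [hTδ i]
  have hGei : ∀ i, weilMellin G (e i) = (c i : ℂ) * (κ i : ℂ) := fun i ↦ by
    rw [hGmellin, Finset.sum_eq_single i]
    · obtain ⟨k, hk⟩ := hTk i
      rw [hgm, hψv i (e i) (he_mem i), if_pos rfl, coshFactor_eq_of_tuned hk, one_mul]
    · intro j _ hji
      rw [hgm, hψv j (e i) (he_mem i), if_neg (fun h ↦ hji (he_inj h).symm)]
      simp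
    · exact fun h ↦ absurd (Finset.mem_univ i) h
  let ez : Fin n → riemannZetaNontrivialZeros := fun i ↦ ⟨e i, he_ntz i⟩
  have hez_inj : Function.Injective ez := fun i j h ↦ he_inj (congrArg Subtype.val h :)
  have hXi : ∀ i, X (ez i) = c i * κ i := fun i ↦ by
    simp only [hXdef]
    show (weilMellin G (e i)).re = c i * κ i
    rw [hGei]
    simp [Complex.mul_re]
  have hXsum : S * (Λ + 1) ≤
      ∑' ρ : riemannZetaNontrivialZeros, (riemannZetaZeroOrder (ρ : ℂ) : ℝ) * X ρ ^ 2 := by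
    have h1 : ∑ ρ ∈ Finset.univ.image ez, (riemannZetaZeroOrder (ρ : ℂ) : ℝ) * X ρ ^ 2 ≤
        ∑' ρ : riemannZetaNontrivialZeros, (riemannZetaZeroOrder (ρ : ℂ) : ℝ) * X ρ ^ 2 :=
      hsumX.sum_le_tsum _ fun ρ _ ↦ mul_nonneg (hm0 ρ) (sq_nonneg _)
    rw [Finset.sum_image fun i _ j _ h ↦ hez_inj h] at h1
    refine le_trans ?_ h1
    rw [hSdef, Finset.sum_mul]
    refine Finset.sum_le_sum fun i _ ↦ ?_
    rw [hXi]
    have hκ := hκ1 i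
    have hm := hm1 (ez i)
    have hc2 : 0 ≤ c i ^ 2 := sq_nonneg _
    have hΛ1 : 0 ≤ Λ + 1 := by linarith
    calc c i ^ 2 * (Λ + 1) ≤ c i ^ 2 * (Λ + 1) ^ 2 := by
          apply mul_le_mul_of_nonneg_left _ hc2
          nlinarith [mul_nonneg hΛ0 hΛ1]
      _ ≤ c i ^ 2 * κ i ^ 2 := by
          apply mul_le_mul_of_nonneg_left _ hc2
          exact pow_le_pow_left₀ hΛ1 hκ 2
      _ = 1 * (c i * κ i) ^ 2 := by ring
      _ ≤ (riemannZetaZeroOrder ((ez i : riemannZetaNontrivialZeros) : ℂ) : ℝ) * (c i * κ i) ^ 2 :=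
          mul_le_mul_of_nonneg_right hm (sq_nonneg _)
  -- Step 9: conclusion `Re Q(G) ≤ S Λ - S (Λ + 1) = -S < 0`
  rw [hre]
  linarith [hXsum, hYsum, hSpos]

/-! ## D. Consequences: the odd lower half holds; odd index `= K`, real index `= 2K` exactly (`K < ∞`) -/

/-- The HYPOTHESIS binder `OddIndexLowerHalf` of part 3 is a THEOREM. [cite: Bombieri2000Weil, Thm 9] -/
theorem oddIndexLowerHalf : OddIndexLowerHalf := fun hfin n hn ↦ by
  obtain ⟨A, g, h1, h2, h3, h4, h5⟩ := exists_negative_definite_odd_family_of_finite hfin hn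
  have hA : OddNegIndexAtLeast n A := ⟨g, h1, h2, h3, h4, h5⟩
  exact ⟨A, fun a ha ↦ OddNegIndexAtLeast.mono hA ha⟩

/-- Odd index on long windows is EXACTLY `K` (`K < ∞`): `(∃ a, OddNegIndexAtLeast n a) ↔ n ≤ K`.
[cite: Bombieri2000Weil, Thm 9 (odd part)] -/
theorem exists_oddNegIndexAtLeast_iff (hfin : Set.Finite 𝒬) (n : ℕ) :
    (∃ a : ℝ, OddNegIndexAtLeast n a) ↔ n ≤ hfin.toFinset.card := by
  constructor
  · rintro ⟨a, ha⟩
    have h := le_encard_quadrant_of_oddNegIndexAtLeast ha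
    rw [hfin.encard_eq_coe_toFinset_card] at h
    exact_mod_cast h
  · intro hn
    obtain ⟨A, hA⟩ := oddIndexLowerHalf hfin n hn
    exact ⟨A, hA A le_rfl⟩

/-- Level `n + 1` of the ODD form is clean at every window `⟺ K ≤ n` (`K < ∞`). [cite: Bombieri2000Weil, Thm 9] -/
theorem not_oddNegIndexAtLeast_succ_iff (hfin : Set.Finite 𝒬) (n : ℕ) :
    (∀ a : ℝ, ¬ OddNegIndexAtLeast (n + 1) a) ↔ hfin.toFinset.card ≤ n := by
  have h := exists_oddNegIndexAtLeast_iff hfin (n + 1)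
  constructor
  · intro hno
    by_contra hlt
    obtain ⟨a, ha⟩ := h.2 (by omega)
    exact hno a ha
  · rintro hle a ha
    have := h.1 ⟨a, ha⟩
    omega

/-- The full REAL index on long windows is EXACTLY `2K` (`K < ∞`), unconditionally:
`(∃ a, RealNegIndexAtLeast n a) ↔ n ≤ 2K`. [cite: Bombieri2000Weil, Thm 8] -/
theorem exists_realNegIndexAtLeast_iff (hfin : Set.Finite 𝒬) (n : ℕ) :
    (∃ a : ℝ, RealNegIndexAtLeast n a) ↔ n ≤ 2 * hfin.toFinset.card :=
  exists_realNegIndexAtLeast_iff_of_oddLowerHalf oddIndexLowerHalf hfin n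

/-- Level `n + 1` of the FULL real form is clean at every window `⟺ 2K ≤ n` (`K < ∞`), unconditionally; with
`n = 0, 1` this is RH (M2 packet), with `n = 2` it is `K ≤ 1` (part 3). [cite: Bombieri2000Weil, Thm 8] -/
theorem not_realNegIndexAtLeast_succ_iff (hfin : Set.Finite 𝒬) (n : ℕ) :
    (∀ a : ℝ, ¬ RealNegIndexAtLeast (n + 1) a) ↔ 2 * hfin.toFinset.card ≤ n :=
  not_realNegIndexAtLeast_succ_iff_of_oddLowerHalf oddIndexLowerHalf hfin n

end Summit.RiemannHypothesis.RiemannHypothesis.Theorems.PfPersistenceParityIndex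

end
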